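import Summits.QuantumFields.YangMills.Theorems.SmallFieldWideningLargeFieldMassRefinementTailOfOneRecord
import Summits.QuantumFields.YangMills.Theorems.SmallFieldWideningAdmissibleBlocks
import Summits.QuantumFields.YangMills.Theorems.AlphaInputsT3ACv3RecordXChi
import HarnessLib

/-!
# Route `SmallFieldWidening` — crux r3 `LargeFieldMassRefinementTail` (stmt-QuantumFields-22884) READ PER BLOCK SIZE:
# the r3 BODY at ONE block size `L` from the K2-L sockets of route `UnitScaleTilt` AT THAT `L`, and the admissible-block leaf
# `YM3TorusSU2Adm` from (α) records delivered only ABOVE PRINT'S FLOOR `L > 11`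
# (support file, glue; width seat `ym-line-sfw-p2-w3` gen 5, line `birth` of lead `ym-line-sfw-p2`)

WHY.  Every landed closer of the crux (`…OfHeightTail`, `…OfIntCoreRec`, `…OfOneRecord`, `…RatedOfOneRecord`) has the shape
«hypothesis for EVERY odd block size `L > 1` ⇒ `LargeFieldMassRefinementTail`», because the crux is a `∀ L` statement.  But the
feeders are delivered block size by block size: the (α) socket `AlphaInputsT3ACv3RecChi L`, the data core `AlphaInputsT3AC.IntCoreRec L`,
ONE χ-record `AlphaInputsT3AC.OfV3ChiAt F 𝔠 a₀ a₁` (families of block size `L`) and the lane's displays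
`AlphaInputsT3AC.PinnedPartsT3ACRec{R,X,FL}Chi L` are all indexed by `L`, and the expansion-side inputs of the programme are printed only
above a NUMERICAL FLOOR on the block size ([Balaban1987RG1] §0 p. 251 «L is an odd, positive integer > 11»; the one-step decay transfer
[Balaban1988RG2Cluster] (2.36) is recorded false at `L = 3` with the printed constant, `B13Geometry236Printed`).  If the lane
`pub-balaban3d` ends up exhibiting records only for `L ≥ 13`, NO `∀ L` closer fires and r3 as typed stays open, while the route's
print-faithful leaf `T3YM3TorusStatement.YM3TorusSU2Adm` (every odd `L₀ > 11`) is still within reach: the assembly is already read per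
block size (`SmallFieldWideningBlocks.yM3TorusSU2At_of_bodies`, `…_of_bodies_from_odd`, seat `ym-line-sfw-p1`), and consumes the r3 BODY
at one `L`.  THIS FILE supplies the missing per-block-size links on the r3 side, sorry-free:

* §1 the level-shift bridge AT ONE `L` (`refinedMassAt_of_heightTailAt`, `…_of_averagedTailAt`, `…_of_perPlaquetteAt`): w2's
  `exists_null_mass_bound` is per family, so K2's per-height / averaged-height / per-plaquette packages AT `L` give the r3 body AT `L`;
* §2 the record-level closers AT ONE `L`: `averagedTailPkgAt_of_oneIntCoreAt` (ONE `IntCoreRec`-body record at `L` — the body of the lead's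
  `averagedTailPkg_of_oneIntCore` is per `L`; tail chain `perPlaquetteHigh_int` → `budget_of_c` → `perPlaquette_of_split` →
  `stub_tailOfPerPlaquette` verbatim), `refinedMassAt_of_oneIntCoreAt`, `refinedMassAt_of_oneChiRecordAt` (ONE χ-record at `L`, at any
  constants), `refinedMassAt_of_alphaInputsT3ACv3RecChi` (the 2′χ socket AT `L`), `refinedMassAt_of_pinnedPartsRec{R,X,FL}Chi` (the lane's
  three seam displays AT `L`, by name through `alphaInputsT3ACv3RecChi_of_pinnedPartsRec…Chi`);
* §3 the leaf per block size: `yM3TorusSU2At_of_allHeightsSmallTilt_of_oneChiRecordAt` (r2 BY NAME + ONE χ-record at `L₀` ⇒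
  `YM3TorusSU2At L₀`), and the FLOORED leaf `yM3TorusSU2Adm_of_allHeightsSmallTilt_of_laneRecordsChi_from` /
  `…_of_pinnedPartsRecFLChi_from` (r2 BY NAME + records for the odd block sizes `L ≥ L₁`, `L₁ ≤ 12` ⇒ `YM3TorusSU2At L₀` for every
  `L₀ ≥ L₁` and `YM3TorusSU2Adm`), plus the same with r2 floored and thresholded (`yM3TorusSU2Adm_of_thresholdedTilt_from_of_laneRecordsChi_from`);
* §4 sanity: inadmissible block sizes carry no family (`refinedMassAt_of_not_admissible`), and the `∀ L` crux is the conjunction of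
  its bodies over the odd `L > 1` (`largeFieldMassRefinementTail_of_forall_refinedMassAt`).

HONEST SCOPE.  Pure bookkeeping over landed theorems; no (α) record is constructed, no large-field estimate is proved, the registered
stub `stub_avgTailPkg`, the crux r3 and route `SmallFieldWidening` stay OPEN; nothing is asserted about which block sizes any feeder
holds for.  No summit is proved (rung R3 RECORD label; the Yang–Mills mass gap is NOT touched by any of this).

References: T. Bałaban, CMP 102 (1985) 255–275 [Balaban1985UV3] ((1)–(3) p.256, (7) p.257, (47) p.267, (71) p.273, Thm 2 p.272);
CMP 102 (1985) 277–309 [Balaban1985Variational] (Thm 1 (8) p.279); CMP 109 (1987) 249–301 [Balaban1987RG1] (§0 p.251).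
-/

set_option autoImplicit false

noncomputable section

open MeasureTheory Filter Topology
open Literature.MathematicalPhysics.QuantumFieldTheory
open Literature.MathematicalPhysics.QuantumFieldTheory.Balaban1983to89
open Literature.MathematicalPhysics.QuantumFieldTheory.Balaban1983to89.Missing
open Literature.MathematicalPhysics.QuantumFieldTheory.Balaban1983to89.T3ContinuumYM3Torus
open Literature.MathematicalPhysics.QuantumFieldTheory.Balaban1983to89.T3YM3TorusStatement
open Literature.MathematicalPhysics.QuantumFieldTheory.Balaban1983to89.T3UnitScaleTilt
open Literature.MathematicalPhysics.QuantumFieldTheory.Balaban1983to89.T3UnitLawDensityEML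
open Literature.MathematicalPhysics.QuantumFieldTheory.Balaban1983to89.T3CruxEstimates
open Literature.MathematicalPhysics.QuantumFieldTheory.Balaban1983to89.T3BareTailProfile
open Literature.MathematicalPhysics.QuantumFieldTheory.Balaban1983to89.T3AveragedTailProfile
open Literature.MathematicalPhysics.QuantumFieldTheory.Balaban1983to89.T3ThresholdSmallness (sqrt_coupling_pos_le)
open Literature.MathematicalPhysics.QuantumFieldTheory.Balaban1983to89.T3Thresholds (coupling_le_one)
open Literature.MathematicalPhysics.QuantumFieldTheory.Balaban1983to89.T3AlphaInputsAC
open Literature.MathematicalPhysics.QuantumFieldTheory.Balaban1983to89.T3AlphaInputsACSchemas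
open Summit.QuantumFields.Balaban3D.Carriers (suGroupModel Hist)
open Summit.QuantumFields.Balaban3D.Proofs.Primitives (AlphaConsts)
open Summit.QuantumFields.YangMills.Theses.SmallFieldWidening (AllHeightsSmallTilt LargeFieldMassRefinementTail)
open Summit.QuantumFields.YangMills.Theorems
open Summit.QuantumFields.YangMills.Theorems.HistoryTailLaneNumerator (budget_of_c)
open Summit.QuantumFields.YangMills.Theorems.HistoryTailLaneTailInt (perPlaquetteHigh_int)
open Summit.QuantumFields.YangMills.Theorems.LargeFieldMassRefinementTailOfHeightTail (exists_null_mass_bound)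
open Summit.QuantumFields.YangMills.Theorems.LargeFieldMassRefinementTailOfOneRecord (intCoreBody_of_ofV3ChiAt)
open Summit.QuantumFields.YangMills.Theorems.SmallFieldWideningBlocks (yM3TorusSU2At_of_bodies thresholded_of_allHeightsBody
  yM3TorusSU2At_of_bodies_from_odd yM3TorusSU2Adm_of_bodies_from yM3TorusSU2Adm_of_allHeightsSmallTilt_of_from)

namespace Summit.QuantumFields.YangMills.Theorems.LargeFieldMassRefinementTailPerBlockSize

/-! ## §1 The level-shift bridge at one block size -/

/-- **THE r3 BODY AT ONE BLOCK SIZE ⇐ K2's PER-HEIGHT ESTIMATE AT THAT BLOCK SIZE**: if for the block size `L` there are a profile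
`(b₀, p₀)` and a threshold `γ₁` such that every family with `F.L = L` at every `0 < γ ≤ γ₁` has `HeightTailAt F γ b₀ p₀`, then the body
of `LargeFieldMassRefinementTail` at `L` holds (one null sequence per family and coupling, all runs of all admissible refinements —
w2's `exists_null_mass_bound`, which is per family). [cite: Balaban1985UV3, (7) p.257 and (71) p.273] -/
theorem refinedMassAt_of_heightTailAt (L : ℕ)
    (h : ∃ b₀ p₀ γ₁ : ℝ, 0 < b₀ ∧ 2 < p₀ ∧ 0 < γ₁ ∧
      ∀ (F : T3Family) (γ : ℝ), F.L = L → 0 < γ → γ ≤ γ₁ → HeightTailAt F γ b₀ p₀) :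
    ∃ (b₀ p₀ γ₁ : ℝ), 0 < b₀ ∧ 2 < p₀ ∧ 0 < γ₁ ∧ ∀ (F : T3Family) (γ : ℝ), F.L = L → 0 < γ →
      ∃ δ : ℕ → ℝ, Tendsto δ atTop (𝓝 0) ∧ ∀ n K : ℕ, γ * ((F.L : ℝ)⁻¹) ^ n ≤ γ₁ →
        (gibbsK (F.refine n) ℰp (γ * ((F.L : ℝ)⁻¹) ^ n) K).real
          (histGood (F.refine n) ℰp (θBal (F.refine n).L (γ * ((F.L : ℝ)⁻¹) ^ n) b₀ p₀) K 0)ᶜ ≤ δ n := by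
  obtain ⟨b₀, p₀, γ₁, hb₀, hp₀, hγ₁, H⟩ := h
  refine ⟨b₀, p₀, γ₁, hb₀, hp₀, hγ₁, fun F γ hFL hγ => ?_⟩
  have hL0 : (0 : ℝ) < F.L := by exact_mod_cast (zero_lt_one.trans F.hL.2)
  exact exists_null_mass_bound F hγ fun n hn =>
    H (F.refine n) _ hFL (mul_pos hγ (pow_pos (inv_pos.mpr hL0) n)) hn

/-- **THE r3 BODY AT ONE BLOCK SIZE ⇐ THE BLOCK-AVERAGED HEIGHTS AT THAT BLOCK SIZE** (`AveragedTailAt` with `γ₁ ≤ 1`; the bare height is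
the tree theorem `T3BareTailProfile.bareTailAt`). [cite: Balaban1985UV3, (71) p.273] -/
theorem refinedMassAt_of_averagedTailAt (L : ℕ)
    (h : ∃ b₀ p₀ γ₁ : ℝ, 0 < b₀ ∧ 2 < p₀ ∧ 0 < γ₁ ∧ γ₁ ≤ 1 ∧
      ∀ (F : T3Family) (γ : ℝ), F.L = L → 0 < γ → γ ≤ γ₁ → AveragedTailAt F γ b₀ p₀) :
    ∃ (b₀ p₀ γ₁ : ℝ), 0 < b₀ ∧ 2 < p₀ ∧ 0 < γ₁ ∧ ∀ (F : T3Family) (γ : ℝ), F.L = L → 0 < γ →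
      ∃ δ : ℕ → ℝ, Tendsto δ atTop (𝓝 0) ∧ ∀ n K : ℕ, γ * ((F.L : ℝ)⁻¹) ^ n ≤ γ₁ →
        (gibbsK (F.refine n) ℰp (γ * ((F.L : ℝ)⁻¹) ^ n) K).real
          (histGood (F.refine n) ℰp (θBal (F.refine n).L (γ * ((F.L : ℝ)⁻¹) ^ n) b₀ p₀) K 0)ᶜ ≤ δ n := by
  refine refinedMassAt_of_heightTailAt L ?_
  obtain ⟨b₀, p₀, γ₁, hb, hp, hγ₁, hγ₁1, h⟩ := h
  exact ⟨b₀, p₀, γ₁, hb, hp, hγ₁, fun F γ hFL hγ hle =>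
    (heightTailAt_iff_averagedTailAt F hγ (hle.trans hγ₁1) hb (by linarith)).mpr (h F γ hFL hγ hle)⟩

/-- **THE r3 BODY AT ONE BLOCK SIZE ⇐ A PER-PLAQUETTE TAIL AT THAT BLOCK SIZE** (constants `C, A, c` depending on the family and the
coupling; `T3AveragedTailProfile.averagedTailAt_of_perPlaquette`). [cite: Balaban1985UV3, (71) p.273] -/
theorem refinedMassAt_of_perPlaquetteAt (L : ℕ)
    (h : ∃ b₀ p₀ γ₁ : ℝ, 0 < b₀ ∧ 2 < p₀ ∧ 0 < γ₁ ∧ γ₁ ≤ 1 ∧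
      ∀ (F : T3Family) (γ : ℝ), F.L = L → 0 < γ → γ ≤ γ₁ →
        ∃ (C : ℝ) (A : ℕ) (c : ℝ), 0 ≤ C ∧ 0 < c ∧
          ∀ (K j : ℕ), 1 ≤ j → j ≤ K → ∀ p : Plaq (F.P K) j,
            (gibbsK F ℰp γ K).real
                {U | θBal F.L γ b₀ p₀ (K - j) ≤
                  GaugeGroup.dist1 (GaugeField.plaqHol
                    (Averaging.iter (fun i => BlockAveraging.blockAvg (P := F.P K) (j := i) ℰp) j U) p)} ≤
              C * (F.scheme ℰp γ).β (K - j) ^ A *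
                Real.exp (-(c * B10.pFun b₀ p₀ (Real.sqrt (γ * ((F.L : ℝ)⁻¹) ^ (K - j))) ^ 2))) :
    ∃ (b₀ p₀ γ₁ : ℝ), 0 < b₀ ∧ 2 < p₀ ∧ 0 < γ₁ ∧ ∀ (F : T3Family) (γ : ℝ), F.L = L → 0 < γ →
      ∃ δ : ℕ → ℝ, Tendsto δ atTop (𝓝 0) ∧ ∀ n K : ℕ, γ * ((F.L : ℝ)⁻¹) ^ n ≤ γ₁ →
        (gibbsK (F.refine n) ℰp (γ * ((F.L : ℝ)⁻¹) ^ n) K).real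
          (histGood (F.refine n) ℰp (θBal (F.refine n).L (γ * ((F.L : ℝ)⁻¹) ^ n) b₀ p₀) K 0)ᶜ ≤ δ n := by
  refine refinedMassAt_of_averagedTailAt L ?_
  obtain ⟨b₀, p₀, γ₁, hb, hp, hγ₁, hγ₁1, h⟩ := h
  exact ⟨b₀, p₀, γ₁, hb, hp, hγ₁, hγ₁1, fun F γ hFL hγ hle =>
    averagedTailAt_of_perPlaquette F hγ (hle.trans hγ₁1) hb (by linarith) (h F γ hFL hγ hle)⟩

/-! ## §2 The record-level closers at one block size -/

/-- **THE AVERAGED-HEIGHT TAIL PACKAGE AT ONE BLOCK SIZE FROM ONE (α) RECORD AT THAT BLOCK SIZE.**  For an odd `L > 1`, ONE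
primitive-constants record `𝔠 : AlphaConsts L 2` and ONE [Balaban1985Variational] constant `a₁ > 0` such that every family with `F.L = L`
at every `0 < γ ≤ (min 𝔠.γ₀ 1)²` admits data cores with constant `a₁` whose interior datum satisfies the a.e. lower row (47)′ once
`θBal ≤ a₁` (the BODY of `AlphaInputsT3AC.IntCoreRec L` at the record's own profile) give `b₀ > 0`, `p₀ > 2`, `0 < γ₁ ≤ 1` with
`AveragedTailAt F γ b₀ p₀` for all families of block size `L` and all `0 < γ ≤ γ₁` — `(b₀, p₀) := (𝔠.b₀, 𝔠.p₀)` (admissible since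
`𝔠.p₀ = 2𝔠.r₀ + 1`, `1 ≤ 𝔠.r₀`).  The lead's `averagedTailPkg_of_oneIntCore` for ONE `L` (same tail chain: `perPlaquetteHigh_int`,
`budget_of_c`, `perPlaquette_of_split`, `stub_tailOfPerPlaquette`). [cite: Balaban1985UV3, (47) p.267 and (71) p.273] -/
theorem averagedTailPkgAt_of_oneIntCoreAt (L : ℕ) (hLo : Odd L) (hL : 1 < L)
    (hone : ∃ (𝔠 : AlphaConsts L (suGroupModel 2).N) (a₁ : ℝ), 0 < a₁ ∧
      ∀ (F : T3Family) (hF : F.L = L) (γ : ℝ) (hγ : 0 < γ) (hγ1 : γ ≤ (min (hF ▸ 𝔠).gamma0 1) ^ 2),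
        ∃ qf : ∀ K, AlphaInputsT3AC.PkgCoreV3 F (hF ▸ 𝔠) γ hγ hγ1 K, (∀ K, (qf K).a₁ = a₁) ∧
          ((∀ i, θBal F.L γ (hF ▸ 𝔠).b₀ (hF ▸ 𝔠).p₀ i ≤ a₁) →
            ∀ (π : AlphaInputsT3AC.PolymerT3 F) (K j : ℕ), j ≤ K → Ineq47AE (AlphaInputsT3AC.dataIntV3 qf π) K j)) :
    ∃ b₀ p₀ γ₁ : ℝ, 0 < b₀ ∧ 2 < p₀ ∧ 0 < γ₁ ∧ γ₁ ≤ 1 ∧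
      ∀ (F : T3Family) (γ : ℝ), F.L = L → 0 < γ → γ ≤ γ₁ → AveragedTailAt F γ b₀ p₀ := by
  obtain ⟨𝔠, a₁, ha1, h𝔠⟩ := hone
  obtain ⟨κ, γ₁, cSF, hκ, hγ₁, hγ₁1, hc0, -, h⟩ := perPlaquetteHigh_int L hLo hL 𝔠 a₁ ha1 h𝔠
  have hb : 0 < 𝔠.b₀ := 𝔠.b₀_pos
  have hp2 : 2 < 𝔠.p₀ := 𝔠.two_lt_p₀
  have hr₀ : 0 ≤ 𝔠.r₀ := zero_le_one.trans 𝔠.one_le_r₀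
  have hp : 1 + 3 * 𝔠.r₀ / 2 < 𝔠.p₀ := by
    have := 𝔠.one_le_r₀
    show 1 + 3 * 𝔠.r₀ / 2 < 2 * 𝔠.r₀ + 1
    linarith
  obtain ⟨C₆, c, hC₆, hc, hbud⟩ := budget_of_c 𝔠.b₀ 𝔠.p₀ 𝔠.r₀ κ cSF hb hr₀ hκ hp hc0
  refine ⟨𝔠.b₀, 𝔠.p₀, γ₁, hb, hp2, hγ₁, hγ₁1, fun F γ hFL hγ hle => ?_⟩
  have hγ1 : γ ≤ 1 := hle.trans hγ₁1
  have hp01 : (1 : ℝ) ≤ 𝔠.p₀ := by linarith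
  have hL1 : 1 ≤ F.L := F.hL.2.le
  obtain ⟨j₀, C, A, hC, hhigh⟩ := h F γ hFL hγ hle
  have hhigh' : ∃ (C : ℝ) (A : ℕ) (c : ℝ), 0 ≤ C ∧ 0 < c ∧
      ∀ (K j : ℕ), j₀ < j → j ≤ K → ∀ p : Plaq (F.P K) j,
        (gibbsK F ℰp γ K).real
            {U | θBal F.L γ 𝔠.b₀ 𝔠.p₀ (K - j) ≤
              GaugeGroup.dist1 (GaugeField.plaqHol
                (Averaging.iter (fun _ => BlockAveraging.blockAvg ℰp) j U) p)} ≤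
          C * (F.scheme ℰp γ).β (K - j) ^ A *
            Real.exp (-(c * B10.pFun 𝔠.b₀ 𝔠.p₀ (Real.sqrt (γ * ((F.L : ℝ)⁻¹) ^ (K - j))) ^ 2)) := by
    refine ⟨C * C₆, A, c, mul_nonneg hC hC₆, hc, fun K j hj hjK p => ?_⟩
    have hg := sqrt_coupling_pos_le hL1 hγ (K - j)
    have hg1 := coupling_le_one hL1 hγ hγ1 (K - j)
    have hβA : 0 ≤ C * (F.scheme ℰp γ).β (K - j) ^ A :=
      mul_nonneg hC (pow_nonneg (F.scheme_β_nonneg ℰp hγ.le (K - j)) A)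
    calc (gibbsK F ℰp γ K).real
            {U | θBal F.L γ 𝔠.b₀ 𝔠.p₀ (K - j) ≤
              GaugeGroup.dist1 (GaugeField.plaqHol
                (Averaging.iter (fun _ => BlockAveraging.blockAvg ℰp) j U) p)}
          ≤ C * (F.scheme ℰp γ).β (K - j) ^ A *
              Real.exp (-(cSF * B10.pFun 𝔠.b₀ 𝔠.p₀ (Real.sqrt (γ * ((F.L : ℝ)⁻¹) ^ (K - j))) ^ 2) +
                κ * (1 + Real.log (Real.sqrt (γ * ((F.L : ℝ)⁻¹) ^ (K - j)))⁻¹) ^ (2 + 3 * 𝔠.r₀)) := hhigh K j hj hjK p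
      _ ≤ C * (F.scheme ℰp γ).β (K - j) ^ A *
              (C₆ * Real.exp (-(c * B10.pFun 𝔠.b₀ 𝔠.p₀ (Real.sqrt (γ * ((F.L : ℝ)⁻¹) ^ (K - j))) ^ 2))) :=
            mul_le_mul_of_nonneg_left (hbud _ hg.1 hg1) hβA
      _ = C * C₆ * (F.scheme ℰp γ).β (K - j) ^ A *
              Real.exp (-(c * B10.pFun 𝔠.b₀ 𝔠.p₀ (Real.sqrt (γ * ((F.L : ℝ)⁻¹) ^ (K - j))) ^ 2)) := by ring
  have hPP := HistoryTailBoundedHeight.perPlaquette_of_split j₀ F hγ hγ1 hb.le 𝔠.p₀ hhigh'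
  exact HistoryTailBirthV3b.stub_tailOfPerPlaquette F γ 𝔠.b₀ 𝔠.p₀ hγ hγ1 hb hp01 hPP

/-- **THE r3 BODY AT ONE BLOCK SIZE ⇐ ONE `IntCoreRec`-BODY RECORD AT THAT BLOCK SIZE** (`averagedTailPkgAt_of_oneIntCoreAt` + the per-`L`
bridge `refinedMassAt_of_averagedTailAt`). [cite: Balaban1985UV3, (7) p.257, (47) p.267 and (71) p.273] -/
theorem refinedMassAt_of_oneIntCoreAt (L : ℕ) (hLo : Odd L) (hL : 1 < L)
    (hone : ∃ (𝔠 : AlphaConsts L (suGroupModel 2).N) (a₁ : ℝ), 0 < a₁ ∧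
      ∀ (F : T3Family) (hF : F.L = L) (γ : ℝ) (hγ : 0 < γ) (hγ1 : γ ≤ (min (hF ▸ 𝔠).gamma0 1) ^ 2),
        ∃ qf : ∀ K, AlphaInputsT3AC.PkgCoreV3 F (hF ▸ 𝔠) γ hγ hγ1 K, (∀ K, (qf K).a₁ = a₁) ∧
          ((∀ i, θBal F.L γ (hF ▸ 𝔠).b₀ (hF ▸ 𝔠).p₀ i ≤ a₁) →
            ∀ (π : AlphaInputsT3AC.PolymerT3 F) (K j : ℕ), j ≤ K → Ineq47AE (AlphaInputsT3AC.dataIntV3 qf π) K j)) :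
    ∃ (b₀ p₀ γ₁ : ℝ), 0 < b₀ ∧ 2 < p₀ ∧ 0 < γ₁ ∧ ∀ (F : T3Family) (γ : ℝ), F.L = L → 0 < γ →
      ∃ δ : ℕ → ℝ, Tendsto δ atTop (𝓝 0) ∧ ∀ n K : ℕ, γ * ((F.L : ℝ)⁻¹) ^ n ≤ γ₁ →
        (gibbsK (F.refine n) ℰp (γ * ((F.L : ℝ)⁻¹) ^ n) K).real
          (histGood (F.refine n) ℰp (θBal (F.refine n).L (γ * ((F.L : ℝ)⁻¹) ^ n) b₀ p₀) K 0)ᶜ ≤ δ n :=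
  refinedMassAt_of_averagedTailAt L (averagedTailPkgAt_of_oneIntCoreAt L hLo hL hone)

/-- **THE r3 BODY AT ONE BLOCK SIZE ⇐ ONE χ-RECORD AT THAT BLOCK SIZE, AT ANY CONSTANTS**: ONE primitive-constants record `𝔠 : AlphaConsts L 2`
and constants `0 < a₀`, `0 < a₁`, `𝔠.B₃·a₁ ≤ a₀` with the χ-package `AlphaInputsT3AC.OfV3ChiAt F 𝔠 a₀ a₁` for every family of block size
`L` give the r3 body at `L` (`intCoreBody_of_ofV3ChiAt` instantiates the `IntCoreRec` body).  The FIRST record the (α) lane exhibits at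
block size `L` closes r3 AT `L`. [cite: Balaban1985UV3, Thm 2 p.272 and (71) p.273; Balaban1985Variational, Thm 1 (8) p.279] -/
theorem refinedMassAt_of_oneChiRecordAt (L : ℕ) (hLo : Odd L) (hL : 1 < L)
    (hone : ∃ (𝔠 : AlphaConsts L (suGroupModel 2).N) (a₀ a₁ : ℝ), 0 < a₀ ∧ 0 < a₁ ∧ 𝔠.B₃ * a₁ ≤ a₀ ∧
      ∀ (F : T3Family) (hF : F.L = L), AlphaInputsT3AC.OfV3ChiAt F (hF ▸ 𝔠) a₀ a₁) :
    ∃ (b₀ p₀ γ₁ : ℝ), 0 < b₀ ∧ 2 < p₀ ∧ 0 < γ₁ ∧ ∀ (F : T3Family) (γ : ℝ), F.L = L → 0 < γ →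
      ∃ δ : ℕ → ℝ, Tendsto δ atTop (𝓝 0) ∧ ∀ n K : ℕ, γ * ((F.L : ℝ)⁻¹) ^ n ≤ γ₁ →
        (gibbsK (F.refine n) ℰp (γ * ((F.L : ℝ)⁻¹) ^ n) K).real
          (histGood (F.refine n) ℰp (θBal (F.refine n).L (γ * ((F.L : ℝ)⁻¹) ^ n) b₀ p₀) K 0)ᶜ ≤ δ n := by
  refine refinedMassAt_of_oneIntCoreAt L hLo hL ?_
  obtain ⟨𝔠, a₀, a₁, ha0, ha1, hw, hF⟩ := hone
  refine ⟨𝔠, a₁, ha1, fun F hFL γ hγ hγ1 => ?_⟩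
  subst hFL
  exact intCoreBody_of_ofV3ChiAt (hF F rfl) ⟨ha0, ha1, hw⟩ γ hγ hγ1

/-- **THE r3 BODY AT ONE BLOCK SIZE ⇐ THE 2′χ SOCKET AT THAT BLOCK SIZE** (`AlphaInputsT3ACv3RecChi L`, the shared registered stub text of
cruxes stmt-QuantumFields-19936 / 20520 read at ONE `L`: instantiate its record at the thresholds themselves).
[cite: Balaban1985UV3, (7) p.257 and Thm 2 p.272; Balaban1985Variational, Thm 1 (8) p.279] -/
theorem refinedMassAt_of_alphaInputsT3ACv3RecChi (L : ℕ) (hLo : Odd L) (hL : 1 < L) (hrec : AlphaInputsT3ACv3RecChi L) :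
    ∃ (b₀ p₀ γ₁ : ℝ), 0 < b₀ ∧ 2 < p₀ ∧ 0 < γ₁ ∧ ∀ (F : T3Family) (γ : ℝ), F.L = L → 0 < γ →
      ∃ δ : ℕ → ℝ, Tendsto δ atTop (𝓝 0) ∧ ∀ n K : ℕ, γ * ((F.L : ℝ)⁻¹) ^ n ≤ γ₁ →
        (gibbsK (F.refine n) ℰp (γ * ((F.L : ℝ)⁻¹) ^ n) K).real
          (histGood (F.refine n) ℰp (θBal (F.refine n).L (γ * ((F.L : ℝ)⁻¹) ^ n) b₀ p₀) K 0)ᶜ ≤ δ n := by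
  refine refinedMassAt_of_oneChiRecordAt L hLo hL ?_
  obtain ⟨b₁, p₁, h⟩ := hrec
  obtain ⟨𝔠, a₀, a₁, -, -, ha0, ha1, hw, hF⟩ := h b₁ p₁ le_rfl le_rfl
  exact ⟨𝔠, a₀, a₁, ha0, ha1, hw, hF⟩

/-- **THE r3 BODY AT ONE BLOCK SIZE ⇐ THE LANE's READ-LOCAL DISPLAY (R) AT THAT BLOCK SIZE** (`AlphaInputsT3AC.PinnedPartsT3ACRecRChi L`:
[Balaban1985Variational] Thm 1 displayed + record sizes + (D6R-CHARGED) + the χ data rows, by name through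
`alphaInputsT3ACv3RecChi_of_pinnedPartsRecRChi`). [cite: Balaban1985UV3, Thm 2 p.272; Balaban1985Variational, Thm 1 (8) p.279] -/
theorem refinedMassAt_of_pinnedPartsRecRChi (L : ℕ) (hLo : Odd L) (hL : 1 < L)
    (h : AlphaInputsT3AC.PinnedPartsT3ACRecRChi L) :
    ∃ (b₀ p₀ γ₁ : ℝ), 0 < b₀ ∧ 2 < p₀ ∧ 0 < γ₁ ∧ ∀ (F : T3Family) (γ : ℝ), F.L = L → 0 < γ →
      ∃ δ : ℕ → ℝ, Tendsto δ atTop (𝓝 0) ∧ ∀ n K : ℕ, γ * ((F.L : ℝ)⁻¹) ^ n ≤ γ₁ →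
        (gibbsK (F.refine n) ℰp (γ * ((F.L : ℝ)⁻¹) ^ n) K).real
          (histGood (F.refine n) ℰp (θBal (F.refine n).L (γ * ((F.L : ℝ)⁻¹) ^ n) b₀ p₀) K 0)ᶜ ≤ δ n :=
  refinedMassAt_of_alphaInputsT3ACv3RecChi L hLo hL (alphaInputsT3ACv3RecChi_of_pinnedPartsRecRChi h)

/-- **THE r3 BODY AT ONE BLOCK SIZE ⇐ THE LANE's SEAM-BLIND DISPLAY (X) AT THAT BLOCK SIZE** (`AlphaInputsT3AC.PinnedPartsT3ACRecXChi L`,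
through `alphaInputsT3ACv3RecChi_of_pinnedPartsRecXChi`). [cite: Balaban1985UV3, Thm 2 p.272; Balaban1985Variational, Thm 1 (8) p.279] -/
theorem refinedMassAt_of_pinnedPartsRecXChi (L : ℕ) (hLo : Odd L) (hL : 1 < L)
    (h : AlphaInputsT3AC.PinnedPartsT3ACRecXChi L) :
    ∃ (b₀ p₀ γ₁ : ℝ), 0 < b₀ ∧ 2 < p₀ ∧ 0 < γ₁ ∧ ∀ (F : T3Family) (γ : ℝ), F.L = L → 0 < γ →
      ∃ δ : ℕ → ℝ, Tendsto δ atTop (𝓝 0) ∧ ∀ n K : ℕ, γ * ((F.L : ℝ)⁻¹) ^ n ≤ γ₁ →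
        (gibbsK (F.refine n) ℰp (γ * ((F.L : ℝ)⁻¹) ^ n) K).real
          (histGood (F.refine n) ℰp (θBal (F.refine n).L (γ * ((F.L : ℝ)⁻¹) ^ n) b₀ p₀) K 0)ᶜ ≤ δ n :=
  refinedMassAt_of_alphaInputsT3ACv3RecChi L hLo hL (alphaInputsT3ACv3RecChi_of_pinnedPartsRecXChi h)

/-- **THE r3 BODY AT ONE BLOCK SIZE ⇐ THE LANE's (FL) DISPLAY AT THAT BLOCK SIZE** (`AlphaInputsT3AC.PinnedPartsT3ACRecFLChi L` =
(T) [Balaban1985Variational] Thm 1 + record sizes + (FL) inner fine lifts + (O″χ) the χ data rows — the lane `pub-balaban3d`'s frontier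
display of 2026-08-28, through `alphaInputsT3ACv3RecChi_of_pinnedPartsRecFLChi`).
[cite: Balaban1985UV3, Thm 2 p.272; Balaban1985Variational, Thm 1 (8) p.279] -/
theorem refinedMassAt_of_pinnedPartsRecFLChi (L : ℕ) (hLo : Odd L) (hL : 1 < L)
    (h : AlphaInputsT3AC.PinnedPartsT3ACRecFLChi L) :
    ∃ (b₀ p₀ γ₁ : ℝ), 0 < b₀ ∧ 2 < p₀ ∧ 0 < γ₁ ∧ ∀ (F : T3Family) (γ : ℝ), F.L = L → 0 < γ →
      ∃ δ : ℕ → ℝ, Tendsto δ atTop (𝓝 0) ∧ ∀ n K : ℕ, γ * ((F.L : ℝ)⁻¹) ^ n ≤ γ₁ →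
        (gibbsK (F.refine n) ℰp (γ * ((F.L : ℝ)⁻¹) ^ n) K).real
          (histGood (F.refine n) ℰp (θBal (F.refine n).L (γ * ((F.L : ℝ)⁻¹) ^ n) b₀ p₀) K 0)ᶜ ≤ δ n :=
  refinedMassAt_of_alphaInputsT3ACv3RecChi L hLo hL (alphaInputsT3ACv3RecChi_of_pinnedPartsRecFLChi h)

/-! ## §3 The rung leaf per block size and above a floor -/

/-- **`YM3TorusSU2At L₀` ⇐ r2 BY NAME + ONE χ-RECORD AT `L₀`**: the all-heights tilt (crux `AllHeightsSmallTilt`, every block size) and ONE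
χ-record for the families of the odd block size `L₀ > 1` give the fixed-block-size rung statement at `L₀` (through
`SmallFieldWideningBlocks.yM3TorusSU2At_of_bodies`). [cite: Balaban1985UV3, (1)-(3) p.256 and Thm 2 p.272] -/
theorem yM3TorusSU2At_of_allHeightsSmallTilt_of_oneChiRecordAt (L₀ : ℕ) (hLo : Odd L₀) (hL : 1 < L₀) (hT : AllHeightsSmallTilt)
    (hone : ∃ (𝔠 : AlphaConsts L₀ (suGroupModel 2).N) (a₀ a₁ : ℝ), 0 < a₀ ∧ 0 < a₁ ∧ 𝔠.B₃ * a₁ ≤ a₀ ∧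
      ∀ (F : T3Family) (hF : F.L = L₀), AlphaInputsT3AC.OfV3ChiAt F (hF ▸ 𝔠) a₀ a₁) :
    YM3TorusSU2At L₀ :=
  yM3TorusSU2At_of_bodies L₀ (thresholded_of_allHeightsBody L₀ (hT L₀)) (refinedMassAt_of_oneChiRecordAt L₀ hLo hL hone)

/-- **`YM3TorusSU2At L₀` ⇐ r2 BY NAME + THE 2′χ SOCKET AT `L₀`.** [cite: Balaban1985UV3, (1)-(3) p.256 and Thm 2 p.272] -/
theorem yM3TorusSU2At_of_allHeightsSmallTilt_of_alphaInputsT3ACv3RecChi (L₀ : ℕ) (hLo : Odd L₀) (hL : 1 < L₀)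
    (hT : AllHeightsSmallTilt) (hrec : AlphaInputsT3ACv3RecChi L₀) : YM3TorusSU2At L₀ :=
  yM3TorusSU2At_of_bodies L₀ (thresholded_of_allHeightsBody L₀ (hT L₀))
    (refinedMassAt_of_alphaInputsT3ACv3RecChi L₀ hLo hL hrec)

/-- The r3 body at an INADMISSIBLE block size (`L` even or `L ≤ 1`) holds vacuously: no three-torus family has that block size.
[cite: Balaban1985UV3, (1)-(3) p.256] -/
theorem refinedMassAt_of_not_admissible (L : ℕ) (hL : ¬ (Odd L ∧ 1 < L)) :
    ∃ (b₀ p₀ γ₁ : ℝ), 0 < b₀ ∧ 2 < p₀ ∧ 0 < γ₁ ∧ ∀ (F : T3Family) (γ : ℝ), F.L = L → 0 < γ →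
      ∃ δ : ℕ → ℝ, Tendsto δ atTop (𝓝 0) ∧ ∀ n K : ℕ, γ * ((F.L : ℝ)⁻¹) ^ n ≤ γ₁ →
        (gibbsK (F.refine n) ℰp (γ * ((F.L : ℝ)⁻¹) ^ n) K).real
          (histGood (F.refine n) ℰp (θBal (F.refine n).L (γ * ((F.L : ℝ)⁻¹) ^ n) b₀ p₀) K 0)ᶜ ≤ δ n := by
  refine ⟨1, 3, 1, one_pos, by norm_num, one_pos, fun F γ hFL _ => ?_⟩
  have hF := F.hL
  rw [hFL] at hF
  exact (hL hF).elim

/-- **THE FLOORED RUNG LEAF FROM FLOORED 2′χ SOCKETS**: r2 BY NAME and the socket `AlphaInputsT3ACv3RecChi L` for every ODD block size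
`L ≥ L₁` with `1 < L`, `L₁ ≤ 12` ⇒ `YM3TorusSU2At L₀` for every `L₀ ≥ L₁`, and the print-faithful admissible-block form `YM3TorusSU2Adm`
(every odd `L₀ > 11`, [Balaban1987RG1] §0 p.251) — records delivered only above print's floor still close the admissible-block leaf.
[cite: Balaban1987RG1, §0 p.251] -/
theorem yM3TorusSU2Adm_of_allHeightsSmallTilt_of_laneRecordsChi_from {L₁ : ℕ} (hL₁ : L₁ ≤ 12) (hT : AllHeightsSmallTilt)
    (hrec : ∀ L : ℕ, Odd L → 1 < L → L₁ ≤ L → AlphaInputsT3ACv3RecChi L) :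
    (∀ L₀ : ℕ, L₁ ≤ L₀ → YM3TorusSU2At L₀) ∧ YM3TorusSU2Adm := by
  refine yM3TorusSU2Adm_of_allHeightsSmallTilt_of_from hL₁ hT fun L hLo hL₁L => ?_
  by_cases hL : 1 < L
  · exact refinedMassAt_of_alphaInputsT3ACv3RecChi L hLo hL (hrec L hLo hL hL₁L)
  · exact refinedMassAt_of_not_admissible L fun h => hL h.2

/-- **THE FLOORED RUNG LEAF FROM FLOORED χ-RECORDS**: r2 BY NAME and ONE χ-record per odd block size `L ≥ L₁` (`1 < L`), `L₁ ≤ 12` ⇒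
`YM3TorusSU2At L₀` for every `L₀ ≥ L₁`, and `YM3TorusSU2Adm`. [cite: Balaban1987RG1, §0 p.251] -/
theorem yM3TorusSU2Adm_of_allHeightsSmallTilt_of_chiRecords_from {L₁ : ℕ} (hL₁ : L₁ ≤ 12) (hT : AllHeightsSmallTilt)
    (hone : ∀ (L : ℕ), Odd L → 1 < L → L₁ ≤ L →
      ∃ (𝔠 : AlphaConsts L (suGroupModel 2).N) (a₀ a₁ : ℝ), 0 < a₀ ∧ 0 < a₁ ∧ 𝔠.B₃ * a₁ ≤ a₀ ∧
        ∀ (F : T3Family) (hF : F.L = L), AlphaInputsT3AC.OfV3ChiAt F (hF ▸ 𝔠) a₀ a₁) :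
    (∀ L₀ : ℕ, L₁ ≤ L₀ → YM3TorusSU2At L₀) ∧ YM3TorusSU2Adm := by
  refine yM3TorusSU2Adm_of_allHeightsSmallTilt_of_from hL₁ hT fun L hLo hL₁L => ?_
  by_cases hL : 1 < L
  · exact refinedMassAt_of_oneChiRecordAt L hLo hL (hone L hLo hL hL₁L)
  · exact refinedMassAt_of_not_admissible L fun h => hL h.2

/-- **THE FLOORED RUNG LEAF FROM THE LANE's FLOORED (FL) DISPLAYS**: r2 BY NAME and `AlphaInputsT3AC.PinnedPartsT3ACRecFLChi L` for every odd
`L ≥ L₁` (`1 < L`), `L₁ ≤ 12` ⇒ `YM3TorusSU2At L₀` for every `L₀ ≥ L₁`, and `YM3TorusSU2Adm`. [cite: Balaban1987RG1, §0 p.251] -/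
theorem yM3TorusSU2Adm_of_allHeightsSmallTilt_of_pinnedPartsRecFLChi_from {L₁ : ℕ} (hL₁ : L₁ ≤ 12) (hT : AllHeightsSmallTilt)
    (h : ∀ L : ℕ, Odd L → 1 < L → L₁ ≤ L → AlphaInputsT3AC.PinnedPartsT3ACRecFLChi L) :
    (∀ L₀ : ℕ, L₁ ≤ L₀ → YM3TorusSU2At L₀) ∧ YM3TorusSU2Adm :=
  yM3TorusSU2Adm_of_allHeightsSmallTilt_of_laneRecordsChi_from hL₁ hT fun L hLo hL hL₁L =>
    alphaInputsT3ACv3RecChi_of_pinnedPartsRecFLChi (h L hLo hL hL₁L)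

/-- **BOTH CRUXES FLOORED**: the thresholded r2 body and the 2′χ socket for every odd block size `L ≥ L₁` (`1 < L`), `L₁ ≤ 12` ⇒
`YM3TorusSU2At L₀` for every `L₀ ≥ L₁`, and `YM3TorusSU2Adm` — the reading in which BOTH partner programmes deliver only above print's
floor. [cite: Balaban1987RG1, §0 p.251] -/
theorem yM3TorusSU2Adm_of_thresholdedTilt_from_of_laneRecordsChi_from {L₁ : ℕ} (hL₁ : L₁ ≤ 12)
    (hT : ∀ L : ℕ, Odd L → L₁ ≤ L → ∃ b₁ p₁ : ℝ, ∀ (b₀ p₀ : ℝ), b₁ ≤ b₀ → p₁ ≤ p₀ → 0 < b₀ → 2 < p₀ →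
      ∃ γ₂ : ℝ, 0 < γ₂ ∧ ∀ (F : T3Family) (γ : ℝ), F.L = L → 0 < γ → γ ≤ γ₂ → UnitTiltAt F γ b₀ p₀ 0)
    (hrec : ∀ L : ℕ, Odd L → 1 < L → L₁ ≤ L → AlphaInputsT3ACv3RecChi L) :
    (∀ L₀ : ℕ, L₁ ≤ L₀ → YM3TorusSU2At L₀) ∧ YM3TorusSU2Adm := by
  have hM : ∀ L : ℕ, Odd L → L₁ ≤ L → ∃ (b₀ p₀ γ₁ : ℝ), 0 < b₀ ∧ 2 < p₀ ∧ 0 < γ₁ ∧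
      ∀ (F : T3Family) (γ : ℝ), F.L = L → 0 < γ → ∃ δ : ℕ → ℝ, Tendsto δ atTop (𝓝 0) ∧
        ∀ n K : ℕ, γ * ((F.L : ℝ)⁻¹) ^ n ≤ γ₁ →
          (gibbsK (F.refine n) ℰp (γ * ((F.L : ℝ)⁻¹) ^ n) K).real
            (histGood (F.refine n) ℰp (θBal (F.refine n).L (γ * ((F.L : ℝ)⁻¹) ^ n) b₀ p₀) K 0)ᶜ ≤ δ n := by
    intro L hLo hL₁L
    by_cases hL : 1 < L
    · exact refinedMassAt_of_alphaInputsT3ACv3RecChi L hLo hL (hrec L hLo hL hL₁L)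
    · exact refinedMassAt_of_not_admissible L fun h => hL h.2
  exact ⟨yM3TorusSU2At_of_bodies_from_odd L₁ hT hM, yM3TorusSU2Adm_of_bodies_from hL₁ hT hM⟩

/-! ## §4 Sanity: the `∀ L` crux is the conjunction of its bodies over the admissible block sizes -/

/-- **THE CRUX FROM ITS BODIES AT THE ODD BLOCK SIZES `L > 1`** (inadmissible block sizes are vacuous): `LargeFieldMassRefinementTail`
BY NAME.  With §2 this recovers the landed `∀ L` closers (`…OfOneRecord`, `…OfIntCoreRec`) from their per-block-size halves.
[cite: Balaban1985UV3, (1)-(3) p.256 and (7) p.257] -/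
theorem largeFieldMassRefinementTail_of_forall_refinedMassAt
    (h : ∀ L : ℕ, Odd L → 1 < L →
      ∃ (b₀ p₀ γ₁ : ℝ), 0 < b₀ ∧ 2 < p₀ ∧ 0 < γ₁ ∧ ∀ (F : T3Family) (γ : ℝ), F.L = L → 0 < γ →
        ∃ δ : ℕ → ℝ, Tendsto δ atTop (𝓝 0) ∧ ∀ n K : ℕ, γ * ((F.L : ℝ)⁻¹) ^ n ≤ γ₁ →
          (gibbsK (F.refine n) ℰp (γ * ((F.L : ℝ)⁻¹) ^ n) K).real
            (histGood (F.refine n) ℰp (θBal (F.refine n).L (γ * ((F.L : ℝ)⁻¹) ^ n) b₀ p₀) K 0)ᶜ ≤ δ n) :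
    LargeFieldMassRefinementTail := by
  intro L
  by_cases hL : Odd L ∧ 1 < L
  · exact h L hL.1 hL.2
  · exact refinedMassAt_of_not_admissible L hL

/-- The per-block-size closer recovers the landed `∀ L` one: ONE χ-record per odd `L > 1` ⇒ the crux BY NAME (= the statement of
`LargeFieldMassRefinementTailOfOneRecord.largeFieldMassRefinementTail_of_oneChiRecord`, re-derived through §2 + §4 as a consistency check).
[cite: Balaban1985UV3, Thm 2 p.272 and (71) p.273] -/
theorem largeFieldMassRefinementTail_of_chiRecords
    (hone : ∀ (L : ℕ), Odd L → 1 < L →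
      ∃ (𝔠 : AlphaConsts L (suGroupModel 2).N) (a₀ a₁ : ℝ), 0 < a₀ ∧ 0 < a₁ ∧ 𝔠.B₃ * a₁ ≤ a₀ ∧
        ∀ (F : T3Family) (hF : F.L = L), AlphaInputsT3AC.OfV3ChiAt F (hF ▸ 𝔠) a₀ a₁) :
    LargeFieldMassRefinementTail :=
  largeFieldMassRefinementTail_of_forall_refinedMassAt fun L hLo hL => refinedMassAt_of_oneChiRecordAt L hLo hL (hone L hLo hL)

end Summit.QuantumFields.YangMills.Theorems.LargeFieldMassRefinementTailPerBlockSize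

end
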